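import Literature.NumberTheory.EllipticCurves.HeegnerCharIdealEnvelopePowTransferProofs
import Literature.NumberTheory.EllipticCurves.IwasawaAlgebraSemilinearCharIdealProofs
import HarnessLib

/-!
# Crux 4 `BSDpOnCellC` (stmt-BirchSwinnertonDyer-19034), line `telescope`, leaf N2 `stub_weightTwoControl`, sub-leaf W3
# `stub_weightTwoTransport` (transport along the (fd₀) quasi-isomorphism): the MODULE ALGEBRA — a QUASI-INVERSE for an additive
# map with bounded kernel and cokernel, and `(a^e) · char(Y) ⊆ char(Y')` for a pair of maps composing to a non-zero scalar
# (helper, `--supports stmt-BirchSwinnertonDyer-19034 --as helper`; closes nothing)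

Cell `bsd-eis`, width seat `bsd-line-x2-p2` (prover g19, 2026-08-29; D-0154 KEY row 5). THEOREMS ONLY: no definition, no named
fact, no `sorry`, no instance, no notation. The last step of the W3 proof plan of `Cruxes/BSDpOnCellC/Lines/telescopeK2weight2.lean`
(«dually `β : X^{unr}(E) → Y` with `p`-power-killed kernel and cokernel, so `p^{e₁}·char_Λ(Y) ⊆ char_Λ(X^{unr}(E))`
(`charIdeal_eq_mul_of_exact` twice, `exists_span_pow_le_charIdeal_of_isTorsionBy`)»), and the input that produces such pairs from N1's
(fd₀) «`θ₀ : A₂[X] → E[p^∞]` with finite kernel and cokernel»: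

* §1 **`exists_quasiInverse`** — for an additive `θ : P → Q` between modules over a commutative ring `R` that is `R`-linear, whose
  kernel is killed by `a` and with `b • Q ⊆ range θ`, there is an `R`-linear `ψ : Q → P` with `θ (ψ q) = (a * b) • q` and
  `ψ (θ x) = (a * b) • x` (`ψ q := a • (a preimage of b • q)`, well defined modulo `ker θ`); `exists_quasiInverse_comm` — `ψ`
  commutes with every pair of endomorphisms `(g_P, g_Q)` that `θ` intertwines (a Galois action).
* §2 **`isTorsion_of_quasiIso`**, **`exists_span_pow_mul_charIdeal_le_of_smul_le_range`** — over a Noetherian factorial domain,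
  for finitely generated torsion `Y, Y'` and an `R`-linear `v : Y → Y'` with `a • Y' ⊆ range v`, `a ≠ 0`:
  `∃ e, (a^e) · char(Y) ⊆ char(Y')` (`char Y ⊆ char(range v)` along `Y ↠ range v`; `char Y' = char(range v) · char(Y'/range v)`;
  `(a^e) ⊆ char(Y'/range v)` since `a` kills it); `exists_span_pow_mul_charIdeal_le_of_quasiIso` — both directions for a pair
  `u, v` with `v ∘ u = a •`, `u ∘ v = a •`.

HONEST FRAMING: pure module algebra over binders; the Selmer-level transport (the long exact sequences / functoriality producing `β`
from `θ₀`) is NOT done here; nothing about any curve is asserted; BSD is proved for no pair; no registered stub, crux or summit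
statement is proved by this file; closes: none.

References: [GreenbergLNM1716] §4 (quasi-isomorphic Λ-modules, characteristic ideals up to p-powers); [BourbakiAC5to7] Ch. VII §4.5
Prop. 10 (multiplicativity of characteristic ideals); [Washington1997] §13.2.
-/

noncomputable section

-- D-0017: single-problem summit, the namespace repeats the problem name by design.
set_option linter.dupNamespace false
set_option autoImplicit false

open scoped Pointwise
open Literature.NumberTheory.EllipticCurves

namespace Summit.BirchSwinnertonDyer.BirchSwinnertonDyer.Theorems.TelescopeK2QuasiIsoCharIdeal

/-! ## §1 A quasi-inverse -/

section QuasiInverse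

variable {R : Type*} [CommRing R] {P Q : Type*} [AddCommGroup P] [Module R P] [AddCommGroup Q] [Module R Q]

/-- **Quasi-inverse.** If `θ : P → Q` is `R`-linear with kernel killed by `a` and `b • Q ⊆ range θ`, there is an `R`-linear
`ψ : Q → P` with `θ ∘ ψ = (a b) •` and `ψ ∘ θ = (a b) •`. (For N1's (fd₀): `a = #ker θ₀`, `b = #coker θ₀`.)
[cite: GreenbergLNM1716, §4 (quasi-isomorphisms)] [folklore] -/
theorem exists_quasiInverse (θ : P →ₗ[R] Q) (a b : R) (hker : ∀ x ∈ LinearMap.ker θ, a • x = 0)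
    (hrange : ∀ q : Q, b • q ∈ LinearMap.range θ) :
    ∃ ψ : Q →ₗ[R] P, (∀ q : Q, θ (ψ q) = (a * b) • q) ∧ (∀ x : P, ψ (θ x) = (a * b) • x) := by
  classical
  choose pre hpre using hrange
  -- two preimages of the same element differ by `ker θ`, which `a` kills
  have hwd : ∀ x y : P, θ x = θ y → a • x = a • y := by
    intro x y hxy
    have hk : x - y ∈ LinearMap.ker θ := by rw [LinearMap.mem_ker, map_sub, hxy, sub_self]
    have := hker _ hk
    rwa [smul_sub, sub_eq_zero] at this
  refine ⟨{ toFun := fun q => a • pre q, map_add' := fun q q' => ?_, map_smul' := fun r q => ?_ },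
    fun q => ?_, fun x => ?_⟩
  · rw [← smul_add]
    exact hwd _ _ (by rw [hpre, map_add, hpre, hpre, smul_add])
  · rw [RingHom.id_apply, smul_comm]
    exact hwd _ _ (by rw [hpre, map_smul, hpre, smul_comm])
  · change θ (a • pre q) = (a * b) • q
    rw [map_smul, hpre, mul_smul]
  · change a • pre (θ x) = (a * b) • x
    rw [mul_smul]
    exact hwd _ _ (by rw [hpre, map_smul])

/-- The quasi-inverse commutes with every pair of additive endomorphisms intertwined by `θ` (e.g. a Galois action on both sides for
an equivariant `θ`): if `θ ∘ g_P = g_Q ∘ θ` and `g_P`, `g_Q` commute with `a •`, then `ψ ∘ g_Q = g_P ∘ ψ`.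
[cite: GreenbergLNM1716, §4 (quasi-isomorphisms)] [folklore] -/
theorem exists_quasiInverse_comm (θ : P →ₗ[R] Q) (a b : R) (hker : ∀ x ∈ LinearMap.ker θ, a • x = 0)
    (hrange : ∀ q : Q, b • q ∈ LinearMap.range θ) :
    ∃ ψ : Q →ₗ[R] P, (∀ q : Q, θ (ψ q) = (a * b) • q) ∧ (∀ x : P, ψ (θ x) = (a * b) • x) ∧
      ∀ (gP : P →+ P) (gQ : Q →+ Q), (∀ x : P, θ (gP x) = gQ (θ x)) → (∀ x : P, gP (a • x) = a • gP x) →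
        (∀ q : Q, gQ (b • q) = b • gQ q) → ∀ q : Q, ψ (gQ q) = gP (ψ q) := by
  classical
  choose pre hpre using hrange
  have hwd : ∀ x y : P, θ x = θ y → a • x = a • y := by
    intro x y hxy
    have hk : x - y ∈ LinearMap.ker θ := by rw [LinearMap.mem_ker, map_sub, hxy, sub_self]
    have := hker _ hk
    rwa [smul_sub, sub_eq_zero] at this
  refine ⟨{ toFun := fun q => a • pre q, map_add' := fun q q' => ?_, map_smul' := fun r q => ?_ },
    fun q => ?_, fun x => ?_, fun gP gQ hθ hgP hgQ q => ?_⟩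
  · rw [← smul_add]
    exact hwd _ _ (by rw [hpre, map_add, hpre, hpre, smul_add])
  · rw [RingHom.id_apply, smul_comm]
    exact hwd _ _ (by rw [hpre, map_smul, hpre, smul_comm])
  · change θ (a • pre q) = (a * b) • q
    rw [map_smul, hpre, mul_smul]
  · change a • pre (θ x) = (a * b) • x
    rw [mul_smul]
    exact hwd _ _ (by rw [hpre, map_smul])
  · change a • pre (gQ q) = gP (a • pre q)
    rw [hgP]
    exact hwd _ _ (by rw [hpre, hθ, hpre, hgQ])

end QuasiInverse

/-! ## §2 Characteristic ideals along a quasi-isomorphism -/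

section CharIdeal

variable {R : Type*} [CommRing R] [IsNoetherianRing R] [IsDomain R] [UniqueFactorizationMonoid R]
  {Y Y' : Type*} [AddCommGroup Y] [Module R Y] [AddCommGroup Y'] [Module R Y']

omit [IsNoetherianRing R] [UniqueFactorizationMonoid R] in
/-- **Torsion transfers along a quasi-isomorphism**: if `u ∘ v = a •` on `Y` with `a ≠ 0` (`v : Y → Y'`, `u : Y' → Y`) and `Y'` is
torsion, then `Y` is torsion. [cite: GreenbergLNM1716, §4] [folklore] -/
theorem isTorsion_of_quasiIso (v : Y →ₗ[R] Y') (u : Y' →ₗ[R] Y) {a : R} (ha : a ≠ 0) (huv : ∀ y : Y, u (v y) = a • y)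
    (hY' : Module.IsTorsion R Y') : Module.IsTorsion R Y := by
  intro y
  obtain ⟨⟨r, hr⟩, hry⟩ := @hY' (v y)
  refine ⟨⟨a * r, mul_mem (mem_nonZeroDivisors_of_ne_zero ha) hr⟩, ?_⟩
  change (a * r) • y = 0
  change r • v y = 0 at hry
  rw [mul_comm, mul_smul, ← huv, ← map_smul, hry, map_zero]

/-- **`(a^e) · char(Y) ⊆ char(Y')` when `a • Y' ⊆ range v`** for an `R`-linear `v : Y → Y'` between finitely generated torsion
modules over a Noetherian factorial domain, `a ≠ 0`: `char Y = char(ker v) · char(range v) ⊆ char(range v)`,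
`char Y' = char(range v) · char(Y' ⧸ range v)` and `(a^e) ⊆ char(Y' ⧸ range v)` (a finitely generated module killed by `a`).
[cite: GreenbergLNM1716, §4] [cite: BourbakiAC5to7, Ch. VII §4.5 Prop. 10] [cite: Washington1997, §13.2] -/
theorem exists_span_pow_mul_charIdeal_le_of_smul_le_range [Module.Finite R Y] [Module.Finite R Y']
    (hY : Module.IsTorsion R Y) (hY' : Module.IsTorsion R Y') (v : Y →ₗ[R] Y') {a : R} (ha : a ≠ 0)
    (hrange : ∀ y' : Y', a • y' ∈ LinearMap.range v) :
    ∃ e : ℕ, Ideal.span {a ^ e} * Module.charIdeal R Y ≤ Module.charIdeal R Y' := by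
  -- `char Y ⊆ char(range v)`
  have h1 : Module.charIdeal R Y ≤ Module.charIdeal R (LinearMap.range v) := by
    rw [Module.charIdeal_eq_mul_of_surjective hY v.rangeRestrict (LinearMap.surjective_rangeRestrict v)]
    exact Ideal.mul_le_left
  -- `char Y' = char(range v) · char(Y'/range v)`
  have h2 : Module.charIdeal R Y' = Module.charIdeal R (LinearMap.range v) *
      Module.charIdeal R (Y' ⧸ LinearMap.range v) :=
    Module.charIdeal_eq_mul_of_exact hY' (LinearMap.range v).subtype (LinearMap.range v).mkQ
      (Submodule.subtype_injective _) (Submodule.mkQ_surjective _) (LinearMap.exact_subtype_mkQ _)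
  -- `(a^e) ⊆ char(Y'/range v)`
  have hkill : Module.IsTorsionBy R (Y' ⧸ LinearMap.range v) a := by
    intro z
    obtain ⟨y', rfl⟩ := Submodule.Quotient.mk_surjective (LinearMap.range v) z
    rw [← Submodule.Quotient.mk_smul, Submodule.Quotient.mk_eq_zero]
    exact hrange y'
  obtain ⟨e, he⟩ := Module.exists_span_pow_le_charIdeal_of_isTorsionBy (R := R) ha hkill
  refine ⟨e, ?_⟩
  rw [h2, mul_comm]
  exact Ideal.mul_mono h1 he

/-- **Both directions for a quasi-isomorphic pair**: `v : Y → Y'`, `u : Y' → Y` with `u ∘ v = a •`, `v ∘ u = a •`, `a ≠ 0`, on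
finitely generated modules with `Y'` torsion: then `Y` is torsion and `(a^e) · char Y ⊆ char Y'`, `(a^e) · char Y' ⊆ char Y` for one `e`
— «quasi-isomorphic `Λ`-modules have characteristic ideals equal up to `a`-powers». [cite: GreenbergLNM1716, §4]
[cite: BourbakiAC5to7, Ch. VII §4.5 Prop. 10] -/
theorem exists_span_pow_mul_charIdeal_le_of_quasiIso [Module.Finite R Y] [Module.Finite R Y']
    (hY' : Module.IsTorsion R Y') (v : Y →ₗ[R] Y') (u : Y' →ₗ[R] Y) {a : R} (ha : a ≠ 0)
    (huv : ∀ y : Y, u (v y) = a • y) (hvu : ∀ y' : Y', v (u y') = a • y') :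
    Module.IsTorsion R Y ∧ ∃ e : ℕ, Ideal.span {a ^ e} * Module.charIdeal R Y ≤ Module.charIdeal R Y' ∧
      Ideal.span {a ^ e} * Module.charIdeal R Y' ≤ Module.charIdeal R Y := by
  have hY : Module.IsTorsion R Y := isTorsion_of_quasiIso v u ha huv hY'
  obtain ⟨e₁, h₁⟩ := exists_span_pow_mul_charIdeal_le_of_smul_le_range hY hY' v ha
    (fun y' => ⟨u y', hvu y'⟩)
  obtain ⟨e₂, h₂⟩ := exists_span_pow_mul_charIdeal_le_of_smul_le_range hY' hY u ha
    (fun y => ⟨v y, huv y⟩)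
  refine ⟨hY, max e₁ e₂, ?_, ?_⟩
  · refine le_trans (Ideal.mul_mono_left ?_) h₁
    exact Ideal.span_singleton_le_span_singleton.2 (pow_dvd_pow a (le_max_left e₁ e₂))
  · refine le_trans (Ideal.mul_mono_left ?_) h₂
    exact Ideal.span_singleton_le_span_singleton.2 (pow_dvd_pow a (le_max_right e₁ e₂))

end CharIdeal

end Summit.BirchSwinnertonDyer.BirchSwinnertonDyer.Theorems.TelescopeK2QuasiIsoCharIdeal

end
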